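import Literature.AlgebraicGeometry.Motives.AbelianVarietyWeilPairingAnalytic
import Literature.AlgebraicGeometry.Motives.AbelianVarietyWeilPairingPullback
import Literature.AlgebraicGeometry.Motives.AbelianVarietyAmpleRiemannForm
import Literature.AlgebraicGeometry.Motives.ComplexTorusEndomorphismAlgebraEquiv
import Literature.Geometry.Kaehler.ComplexTorusRosati
import HarnessLib

/-!
# The Rosati dual of an endomorphism of a complex abelian variety read on the LEVEL-`N` WEIL PAIRINGS of a divisor:
# `ē_N^Θ((d·f) P, Q) = ē_N^Θ(P, f′ Q)` for `ρ_r(f′) = d · G⁻¹ ᵗρ_r(f) G` (Mumford §20 (3) / §21; Lange §2.4 Prop. 2.4.2)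

Layer `Literature/AlgebraicGeometry/Motives`, namespace `Literature.AlgebraicGeometry.Motives.AbelianVariety`.
THEOREMS ONLY: no definition, no instance, no named fact, no `sorry` (net Literature debt 0).

THE PRINT.  D. Mumford, *Abelian Varieties* (1970), §20 p. 186, property (3) of `e_n`: «`e_n(f(x), ŷ) = e_n(x, f̂(ŷ))`»,
and §23 p. 228 (functorial properties of `e^L`) / §21: for the Weil pairing `e^L(x, y) = ē_n(x, φ_L(y))` of a polarisation and the Rosati involution
`f ↦ f′ = φ_L⁻¹ f̂ φ_L` one has «`e^L(f x, y) = e^L(x, f′ y)`», and (§21 Thm. 1) `Tr(f f′) > 0` for `f ≠ 0`.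
H. Lange, *Abelian Varieties over the Complex Numbers* (2023), §2.4.1 Prop. 2.4.2 (a): «`E(ρ_r(f)(λ), μ) =
E(λ, ρ_r(f′)(μ))` for all `λ, μ ∈ Λ`», Thm. 2.4.9: «`(f, g) ↦ Tr_r(f′g)` is a positive definite symmetric bilinear
form on `End_ℚ(X)`»; §2.7.1 (2.13) / §2.7.4 Exercise (3): the Weil pairing on `X[n]` is `e(2πi n E)`.
J. S. Milne, *Abelian varieties* (1986), §16 pp. 127, 132 («the Riemann form of `λ`», `ē_m^λ`) and §17 (the Rosati
involution).

WHAT IS PROVED, AND HOW IT DEVIATES FROM PRINT.  The tree has no dual abelian variety `Â` and no `f ↦ f̂` on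
endomorphisms; instead it has (i) the Rosati involution of a polarised complex torus in the RATIONAL REPRESENTATION,
`ComplexTorus.rosati G A = G⁻¹ ᵗA G` on `End_ℚ(X) = endAlgRat Φ ⊆ M_ι(ℚ)` (`Geometry/Kaehler/ComplexTorusRosati`:
`rosati_mem_endAlgRat`, Prop. 2.4.2 (a) `twoForm_apply_mulVec_rosati_rat`, Thm. 2.4.9 `trace_rosati_mul_self_pos_rat`),
(ii) `End(A) = End(X)` and `End⁰(A) = End_ℚ(X)` for a complex abelian variety uniformised by the torus `X`
(`endRingEquivOfAnalytification`, `endToEndAlgRat`, `Motives/ComplexTorusHomEquivalence`, `…EndomorphismAlgebraEquiv`),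
and (iii) the analytic ↔ algebraic Weil-pairing bridge `ē_N^Θ(φ(π v), φ(π u)) = e(2πi N E(Φ v, Φ u))`
(`weilPairingLevel_eq_cexp`, `Motives/AbelianVarietyWeilPairingAnalytic`) for the Néron–Severi form `E` of `[𝒪(Θ)^an]`.
From these, for a complex abelian variety `A` with a uniformisation `φ : X = V/Φ(ℤ^ι) → A(ℂ)`, a Cartier divisor `Θ`
with Appell–Humbert datum `p` (`⟦a_p⟧ = [𝒪(Θ)^an]`) whose form `η = p.form` is a Riemann form (e.g. `Θ` ample,
`isRiemannForm_of_isAmple`), and a rational Gram matrix `G` (`G ⊗ ℝ = latticeGram Φ η`):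

* §1 `exists_rosatiDual` — **the Rosati dual exists as an endomorphism after clearing one denominator**: for every
  `f ∈ End(A)` there are `d ∈ ℤ ∖ 0` and `f′ ∈ End(A)` with `ρ_r(f′) = d · rosati G ρ_r(f)` (Lemma 2.4.1: `′` maps
  `End_ℚ(X)` to itself — no Lefschetz theorem, no dual variety);
* §2 `map_apply_proj` — `u(φ(π v)) = φ(π(ρ_r(u) v))`: endomorphisms act on uniformised points through their integer
  matrices;
* §3 **`weilPairingLevel_map_rosatiDual` — `ē_N^Θ((d·f) P, Q) = ē_N^Θ(P, f′ Q)` for ALL `N` and all `P, Q ∈ A[N](ℂ)`**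
  (Mumford §20 (3) + §23 read on the tree's carriers: both sides are `e(2πi N η(·,·))` of the two sides of Prop. 2.4.2 (a));
  `exists_rosatiDual_weilPairingLevel` packages §1 + §3;
* §4 positivity on `End(A)` / `End⁰(A)`: `trace_rosati_endToEndAlgRat_mul_self_pos`,
  `trace_rosati_endAlgebraEquiv_mul_self_pos` (`Tr(rosati G ρ_r(x) · ρ_r(x)) > 0` for `x ≠ 0`; Thm. 2.4.9 / Mumford §21
  Thm. 1 transported along `End⁰(A) ≃ End_ℚ(X)`).

USE (cell `hodgecm-mathlib`, D-0151, crux `HLiu418` = stmt-HodgeConjecture-24832, d6 card S2′ «G-ros»): §3 is an ALGEBRAIC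
characterisation of the (transcendentally defined) Rosati dual `f′` through Galois-equivariant data (the `ē_N^Θ` of an
`E`-rational `Θ`), from which `Literature/AlgebraicGeometry/ComplexMultiplication/EndFieldCMOfSimpleOverNumberField`
descends `f ↦ f′` to `End⁰_E` and proves that a full-degree endomorphism field of an `E`-simple abelian variety is CM.
The file moves no book (HC_CM is proved only modulo the 7 printed citations until rung 0 closes).

## References
* [MumfordAV1970] D. Mumford, *Abelian Varieties* (1970), §20 (p. 186, property (3) of `e_n`), §21 Thm. 1, §23 (p. 228, functorial properties of e^L).
* [Lange2023AbelianVarietiesComplex] H. Lange, *Abelian Varieties over the Complex Numbers* (2023), §2.4.1 Lemma 2.4.1,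
  Prop. 2.4.2, Thm. 2.4.9 (pp. 113–116); §2.7.1 (2.13), §2.7.4 Exercise (3).
* [Milne1986AbelianVarieties] J. S. Milne, *Abelian varieties*, in Cornell–Silverman (1986), §16 (pp. 127, 132), §17.
* [Lang1983AbelianVarieties] S. Lang, *Abelian Varieties*, Ch. VII §2 (the pairing `e_N`).
-/

noncomputable section

open CategoryTheory AlgebraicGeometry Complex
open scoped Matrix
open Literature.Geometry.Kaehler Literature.Geometry.Kaehler.ComplexTorus
open Literature.NumberTheory.Transcendental Literature.AlgebraicGeometry.HodgeTheory

namespace Literature.AlgebraicGeometry.Motives.AbelianVariety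

variable {A : AbelianVariety ℂ} {ι : Type} [Fintype ι] [DecidableEq ι] {Φ : (ι → ℝ) ≃L[ℝ] (Fin A.dim → ℂ)}
  {φ : ComplexTorus Φ → ComplexPoints A.X} (hφ : IsAnalytification (Fin A.dim → ℂ) A.X A.dim φ)
  (hadd : ∀ x y, φ (x + y) = φ x * φ y)

/-! ### §1 The Rosati dual of an endomorphism exists (as an endomorphism, after clearing one denominator) -/

include hadd in
/-- **The Rosati dual of an endomorphism is an endomorphism, up to one denominator** (Lange Lemma 2.4.1: `′` is an
anti-involution ON `End_ℚ(X)`): for a Riemann form `η` with rational Gram matrix `G` and `f ∈ End(A)` there are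
`d ∈ ℤ ∖ 0` and `f′ ∈ End(A)` with `ρ_r(f′) = d · G⁻¹ ᵗρ_r(f) G` in `M_ι(ℚ)` — `rosati G ρ_r(f) ∈ End_ℚ(X)`
(`rosati_mem_endAlgRat`) is `d⁻¹ ·` an integral element (`exists_zsmul_eq_endRingIntToEndAlgRat`), which IS an
endomorphism of `A` (`endRingEquivOfAnalytification`).
[cite: Lange2023AbelianVarietiesComplex, §2.4.1 Lemma 2.4.1 (p. 113)] [cite: MumfordAV1970, §20 (p. 189, the Rosati involution)] -/
theorem exists_rosatiDual {η : (Fin A.dim → ℂ) [⋀^Fin 2]→L[ℝ] ℝ} (hR : IsRiemannForm Φ η) {G : Matrix ι ι ℚ}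
    (hG : G.map (Rat.cast : ℚ → ℝ) = latticeGram Φ η) (f : End A) :
    ∃ (d : ℤ) (f' : End A), d ≠ 0 ∧
      ((endToEndAlgRat hφ hadd f' : endAlgRat Φ) : Matrix ι ι ℚ) =
        d • rosati G ((endToEndAlgRat hφ hadd f : endAlgRat Φ) : Matrix ι ι ℚ) := by
  have hmem : rosati G ((endToEndAlgRat hφ hadd f : endAlgRat Φ) : Matrix ι ι ℚ) ∈ endAlgRat Φ :=
    rosati_mem_endAlgRat Φ hR.1 hR.2.2 hG (endToEndAlgRat hφ hadd f).2
  obtain ⟨M, d, hd, hdM⟩ := exists_zsmul_eq_endRingIntToEndAlgRat (Φ := Φ) ⟨_, hmem⟩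
  refine ⟨d, endRingEquivOfAnalytification hφ hadd M, hd, ?_⟩
  rw [endToEndAlgRat_apply, RingEquiv.symm_apply_apply]
  have := congrArg (fun P : endAlgRat Φ => (P : Matrix ι ι ℚ)) hdM
  simpa using this.symm

/-! ### §2 Endomorphisms on the uniformised points: `u(φ(π v)) = φ(π(ρ_r(u) v))` -/

include hadd in
/-- **An endomorphism `u` of `A` acts on the uniformised point `φ(π v)` through its integer matrix**: `u(φ(π v)) =
φ(π(ρ_r(u)_ℝ v))` (`endRingEquivOfAnalytification_symm_spec` + `mapMatrix_proj`).
[cite: Lange2023AbelianVarietiesComplex, §1.1.2 (pp. 9–10) and §2.1.4 Cor. 2.1.17] -/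
theorem map_apply_proj (u : End A) (v : ι → ℝ) :
    AlgPoints.map u.hom.hom.hom (φ (proj Φ v)) =
      φ (proj Φ ((((endRingEquivOfAnalytification hφ hadd).symm u : endRingInt Φ) : Matrix ι ι ℤ).map
        (Int.cast : ℤ → ℝ) *ᵥ v)) := by
  rw [← endRingEquivOfAnalytification_symm_spec hφ hadd u (proj Φ v), mapMatrix_proj]

/-! ### §3 The level-`N` adjunction `ē_N^Θ((d·f) P, Q) = ē_N^Θ(P, f′ Q)` -/

omit [Fintype ι] [DecidableEq ι] in
/-- `ℤ → ℚ → ℝ` casts of an integer matrix. [folklore] -/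
private theorem map_intCast_map_ratCast' (M : Matrix ι ι ℤ) :
    (M.map (Int.cast : ℤ → ℚ)).map (Rat.cast : ℚ → ℝ) = M.map (Int.cast : ℤ → ℝ) :=
  Matrix.ext fun i j ↦ Rat.cast_intCast (M i j)

omit [Fintype ι] [DecidableEq ι] in
/-- Casting commutes with integer scalars on integer matrices. [folklore] -/
private theorem map_zsmul_intCast {R : Type*} [Ring R] (d : ℤ) (M : Matrix ι ι ℤ) :
    (d • M).map (Int.cast : ℤ → R) = d • M.map (Int.cast : ℤ → R) := by
  ext i j
  simp [Matrix.smul_apply, zsmul_eq_mul, Int.cast_mul]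

/-- The integer matrix of `d • f` is `d •` that of `f`. [folklore] -/
private theorem coe_symm_zsmul (d : ℤ) (f : End A) :
    (((endRingEquivOfAnalytification hφ hadd).symm (d • f) : endRingInt Φ) : Matrix ι ι ℤ) =
      d • (((endRingEquivOfAnalytification hφ hadd).symm f : endRingInt Φ) : Matrix ι ι ℤ) := by
  rw [map_zsmul]
  rfl

include hφ hadd in
/-- **Mumford §20 (3) / §23 on the tree's carriers: `ē_N^Θ((d·f) P, Q) = ē_N^Θ(P, f′ Q)`** for every level `N`
and all `P, Q ∈ A[N](ℂ)`, whenever `ρ_r(f′) = d · rosati G ρ_r(f)` for the rational Gram matrix `G` of the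
Néron–Severi form `η = p.form` of an Appell–Humbert datum `p` of `[𝒪(Θ)^an]`, `η` a Riemann form.  Proof: write
`P = φ(π v)`, `Q = φ(π u)`; both sides are `e(2πi N η(·,·))` (`weilPairingLevel_eq_cexp`) of the two sides of
Prop. 2.4.2 (a) `η(Φ((d ρ_r f) v), Φ u) = η(Φ v, Φ(ρ_r(f′) u))` (`twoForm_apply_mulVec_rosati_rat`).
[cite: MumfordAV1970, §20 (p. 186, property (3) of e_n) and §23 (p. 228, functorial properties of e^L)]
[cite: Lange2023AbelianVarietiesComplex, §2.4.1 Prop. 2.4.2 (a) (p. 113) and §2.7.1 (2.13)]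
[cite: Milne1986AbelianVarieties, §16 (pp. 127, 132)] -/
theorem weilPairingLevel_map_rosatiDual (Θ : CartierDivisor A.X.left) (p : AHData Φ)
    (hp : AHData.toPic p = picClass (cartierDivisorLineBundle hφ Θ)) (hR : IsRiemannForm Φ p.form)
    {G : Matrix ι ι ℚ} (hG : G.map (Rat.cast : ℚ → ℝ) = latticeGram Φ p.form)
    {f f' : End A} {d : ℤ}
    (hff' : ((endToEndAlgRat hφ hadd f' : endAlgRat Φ) : Matrix ι ι ℚ) =
      d • rosati G ((endToEndAlgRat hφ hadd f : endAlgRat Φ) : Matrix ι ι ℚ))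
    {N : ℕ} [IsDominant (Hom.toSchemeHom ((N : ℤ) • 𝟙 A))] (P Q : A.torsionPoints ℂ N) :
    A.weilPairingLevel Θ ⟨AlgPoints.map (d • f).hom.hom.hom P.1, map_mem_torsionPoints (d • f) P.2⟩ Q =
      A.weilPairingLevel Θ P ⟨AlgPoints.map f'.hom.hom.hom Q.1, map_mem_torsionPoints f' Q.2⟩ := by
  -- lattice coordinates of `P`, `Q`
  obtain ⟨s, hs⟩ := hφ.isHomeomorph.surjective (P : A.Points ℂ)
  obtain ⟨w, hw⟩ := hφ.isHomeomorph.surjective (Q : A.Points ℂ)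
  obtain ⟨v, rfl⟩ : ∃ v, proj Φ v = s := ⟨lift Φ s, proj_lift Φ s⟩
  obtain ⟨u, rfl⟩ : ∃ u, proj Φ u = w := ⟨lift Φ w, proj_lift Φ w⟩
  set eR := endRingEquivOfAnalytification hφ hadd with heR
  set Mf : Matrix ι ι ℤ := ((eR.symm f : endRingInt Φ) : Matrix ι ι ℤ) with hMf
  set Mf' : Matrix ι ι ℤ := ((eR.symm f' : endRingInt Φ) : Matrix ι ι ℤ) with hMf'
  -- the images in lattice coordinates
  have hP' : ((⟨AlgPoints.map (d • f).hom.hom.hom P.1, map_mem_torsionPoints (d • f) P.2⟩ :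
      A.torsionPoints ℂ N) : A.Points ℂ) = φ (proj Φ ((d • Mf).map (Int.cast : ℤ → ℝ) *ᵥ v)) := by
    change AlgPoints.map (d • f).hom.hom.hom P.1 = _
    rw [← hs, map_apply_proj hφ hadd, coe_symm_zsmul hφ hadd]
  have hQ' : ((⟨AlgPoints.map f'.hom.hom.hom Q.1, map_mem_torsionPoints f' Q.2⟩ :
      A.torsionPoints ℂ N) : A.Points ℂ) = φ (proj Φ (Mf'.map (Int.cast : ℤ → ℝ) *ᵥ u)) := by
    change AlgPoints.map f'.hom.hom.hom Q.1 = _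
    rw [← hw, map_apply_proj hφ hadd]
  -- the matrices over `ℚ`: `ρ_r(f′) = rosati G (d ρ_r(f))`
  have hrat : Mf'.map (Int.cast : ℤ → ℚ) = rosati G ((d • Mf).map (Int.cast : ℤ → ℚ)) := by
    have h1 : ((endToEndAlgRat hφ hadd f' : endAlgRat Φ) : Matrix ι ι ℚ) = Mf'.map (Int.cast : ℤ → ℚ) := by
      rw [endToEndAlgRat_apply, coe_endRingIntToEndAlgRat]
    have h2 : ((endToEndAlgRat hφ hadd f : endAlgRat Φ) : Matrix ι ι ℚ) = Mf.map (Int.cast : ℤ → ℚ) := by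
      rw [endToEndAlgRat_apply, coe_endRingIntToEndAlgRat]
    rw [← h1, hff', h2, map_zsmul_intCast, ← Int.cast_smul_eq_zsmul ℚ d (Mf.map _), rosati_smul,
      Int.cast_smul_eq_zsmul]
  -- Prop. 2.4.2 (a): `η(Φ((d ρ_r f) v), Φ u) = η(Φ v, Φ(ρ_r(f′) u))`
  have hGu : IsUnit (latticeGram Φ p.form).det := isUnit_det_latticeGram Φ hR.1 hR.2.2
  have key : p.form ![Φ ((d • Mf).map (Int.cast : ℤ → ℝ) *ᵥ v), Φ u] =
      p.form ![Φ v, Φ (Mf'.map (Int.cast : ℤ → ℝ) *ᵥ u)] := by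
    rw [← map_intCast_map_ratCast' (d • Mf), twoForm_apply_mulVec_rosati_rat Φ hG hGu, ← hrat,
      map_intCast_map_ratCast']
  rw [weilPairingLevel_eq_cexp hφ hadd Θ p hp _ u _ Q hP' hw.symm,
    weilPairingLevel_eq_cexp hφ hadd Θ p hp v _ P _ hs.symm hQ', key]

include hφ hadd in
/-- **§1 + §3 packaged: every endomorphism `f` of `A` has a Rosati dual `f′ ∈ End(A)` with denominator `d ≠ 0`, read on
ALL level Weil pairings of `Θ`: `ē_N^Θ((d·f) P, Q) = ē_N^Θ(P, f′ Q)`.**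
[cite: MumfordAV1970, §20 (p. 186, property (3) of e_n), §21, §23 (p. 228, functorial properties of e^L)]
[cite: Lange2023AbelianVarietiesComplex, §2.4.1 Lemma 2.4.1 and Prop. 2.4.2 (a) (p. 113)] -/
theorem exists_rosatiDual_weilPairingLevel (Θ : CartierDivisor A.X.left) (p : AHData Φ)
    (hp : AHData.toPic p = picClass (cartierDivisorLineBundle hφ Θ)) (hR : IsRiemannForm Φ p.form)
    {G : Matrix ι ι ℚ} (hG : G.map (Rat.cast : ℚ → ℝ) = latticeGram Φ p.form) (f : End A) :
    ∃ (d : ℤ) (f' : End A), d ≠ 0 ∧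
      ((endToEndAlgRat hφ hadd f' : endAlgRat Φ) : Matrix ι ι ℚ) =
        d • rosati G ((endToEndAlgRat hφ hadd f : endAlgRat Φ) : Matrix ι ι ℚ) ∧
      ∀ (N : ℕ) [IsDominant (Hom.toSchemeHom ((N : ℤ) • 𝟙 A))] (P Q : A.torsionPoints ℂ N),
        A.weilPairingLevel Θ ⟨AlgPoints.map (d • f).hom.hom.hom P.1, map_mem_torsionPoints (d • f) P.2⟩ Q =
          A.weilPairingLevel Θ P ⟨AlgPoints.map f'.hom.hom.hom Q.1, map_mem_torsionPoints f' Q.2⟩ := by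
  obtain ⟨d, f', hd, hff'⟩ := exists_rosatiDual hφ hadd hR hG f
  exact ⟨d, f', hd, hff', fun N _ P Q => weilPairingLevel_map_rosatiDual hφ hadd Θ p hp hR hG hff' P Q⟩

/-! ### §4 Positivity of the Rosati trace form on `End(A)` and `End⁰(A)` (Lange Thm. 2.4.9; Mumford §21 Thm. 1) -/

include hadd in
/-- **`Tr(ρ_r(f)′ ρ_r(f)) > 0` for a non-zero endomorphism `f` of `A`** (Thm. 2.4.9 in the rational representation,
`trace_rosati_mul_self_pos_rat`, transported along the injective `endToEndAlgRat`).
[cite: Lange2023AbelianVarietiesComplex, §2.4.1 Theorem 2.4.9 (p. 116)] [cite: MumfordAV1970, §21 Thm. 1] -/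
theorem trace_rosati_endToEndAlgRat_mul_self_pos {η : (Fin A.dim → ℂ) [⋀^Fin 2]→L[ℝ] ℝ} (hR : IsRiemannForm Φ η)
    {G : Matrix ι ι ℚ} (hG : G.map (Rat.cast : ℚ → ℝ) = latticeGram Φ η) {f : End A} (hf : f ≠ 0) :
    0 < (rosati G ((endToEndAlgRat hφ hadd f : endAlgRat Φ) : Matrix ι ι ℚ) *
      ((endToEndAlgRat hφ hadd f : endAlgRat Φ) : Matrix ι ι ℚ)).trace := by
  refine trace_rosati_mul_self_pos_rat Φ hR.1 hR.2.2 hG (endToEndAlgRat hφ hadd f).2 fun h0 => hf ?_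
  exact endToEndAlgRat_injective hφ hadd (Subtype.ext (h0.trans (by rw [map_zero]; rfl)))

include hadd in
/-- **`Tr(ρ_r(x)′ ρ_r(x)) > 0` for a non-zero `x ∈ End⁰(A)`**, through `End⁰(A) ≃ₐ[ℚ] End_ℚ(X)`
(`endAlgebraEquivOfAnalytification`). [cite: Lange2023AbelianVarietiesComplex, §2.4.1 Theorem 2.4.9 (p. 116)]
[cite: MumfordAV1970, §21 Thm. 1] -/
theorem trace_rosati_endAlgebraEquiv_mul_self_pos {η : (Fin A.dim → ℂ) [⋀^Fin 2]→L[ℝ] ℝ} (hR : IsRiemannForm Φ η)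
    {G : Matrix ι ι ℚ} (hG : G.map (Rat.cast : ℚ → ℝ) = latticeGram Φ η) {x : A.endAlgebra} (hx : x ≠ 0) :
    0 < (rosati G ((endAlgebraEquivOfAnalytification hφ hadd x : endAlgRat Φ) : Matrix ι ι ℚ) *
      ((endAlgebraEquivOfAnalytification hφ hadd x : endAlgRat Φ) : Matrix ι ι ℚ)).trace := by
  refine trace_rosati_mul_self_pos_rat Φ hR.1 hR.2.2 hG (endAlgebraEquivOfAnalytification hφ hadd x).2
    fun h0 => hx ?_
  exact (endAlgebraEquivOfAnalytification hφ hadd).injective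
    (Subtype.ext (h0.trans (by rw [map_zero]; rfl)))

end Literature.AlgebraicGeometry.Motives.AbelianVariety

end
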